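import Summits.ValiantsHypothesis.ValiantsHypothesis.Theorems.LacunarySymmetroidMatrixDescartesDoorA26WallBubblingChainCeiling

/-!
# Wall bubbling for `DoorA26` — the chain ceiling on the SPECIAL strata: slack one (arithmetic only)

LINE / STUBS.  Crux `Theses.LacunarySymmetroid.DoorA26` (stmt-ValiantsHypothesis-19979; OPEN, typed, never asserted), line
`Cruxes/DoorA26/Lines/wall_bubbling.lean` (val-idea-15), obligation (W); statement file `Cruxes/DoorA26/Lines/wall_bubbling_ConfluentDoor.lean` rev 5c,
named residual «(W-split)» / `NoTightChain26`.  Seat val-sym-door-p2 g13 (W1 #38).  W2's count `chain_ceiling` (#17, p663233) reads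
`Σ_c m_c ≤ Σ_{w∈V}(n_w − 1) + (|V| − 1)`; at a GENERIC Weyl face `|V| = 15`, `Σ(n_w − 1) = 6` and the ceiling is `20` FOR EVERY NUMBER OF CLUSTERS
(`chain_ceiling_twenty`, attained by the bookkeeping: `chain_ceiling_attained_two_clusters`) — hence the residual door `NoTightChain26`.  This file records,
as ARITHMETIC ONLY (the inputs `hmono`/`hsplit`/`hcount` at these points are W2's machinery re-run with the special-stratum per-cluster packages W1 #27/#34
+ #26–#26d/#32/#35 + #37; W2's call, R2830), that on the special strata treated by W1 #24–#37 the SAME count has SLACK ONE: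

* `chain_ceiling_nineteen_of_card_fourteen` — ONE Weyl pair on a wall ((a)/(b)): `|V| = 14` values; degree budget `Σ(n_w − 1) = 6` (the merged disjoint
  class has no confluent slot in the frame — wall (a) — resp. its one `t`-slot is a doubleton slot — wall (b), budget unchanged) ⇒ `Σ_c m_c ≤ 19`;
* `chain_ceiling_nineteen_of_twoPairs` — TWO Weyl pairs: `|V| = 10`, budget `10` (`2+2` for the two triples, `2` for the four-member class `e₀+e₁`
  — three slots in the doubly-confluent frame —, `1` for each of the four cross doubletons) ⇒ `≤ 19`;
* `chain_ceiling_seventeen_of_threePairs` — THREE Weyl pairs: `|V| = 6`, budget `12` ⇒ `≤ 17`.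

So «(W-split)» is a GENERIC-FACE phenomenon: wherever a value coincidence or a second Weyl pair removes a slot, the multi-cluster branch closes by the count
as soon as its three inputs are supplied there.  Nothing here is asserted about pencils; nothing bears on `DoorA26`, `MatrixDescartes`
(stmt-ValiantsHypothesis-18050) or `VP ≠ VNP`.  `--supports stmt-ValiantsHypothesis-19979 --as helper`.  [folklore] arithmetic.
-/

-- `Summit.ValiantsHypothesis.ValiantsHypothesis.…` repeats a component by the D-0017 layout
-- (single-conjunct summit), which the `dupNamespace` linter flags; the name is mandated.
set_option linter.dupNamespace false

namespace Summit.ValiantsHypothesis.ValiantsHypothesis.Theorems.LacunarySymmetroidMatrixDescartes.WallBubbling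

open Finset
open scoped BigOperators

/-- **Ceiling 19 at a one-pair WALL point** (`|V| = 14`, degree budget `6`). [folklore] -/
theorem chain_ceiling_nineteen_of_card_fourteen (V : Finset ℝ) (n : ℝ → ℕ) {C : ℕ} (Λ : Fin C → Finset ℝ) (d : Fin C → ℝ → ℕ)
    (m : Fin C → ℕ) (hne : ∀ c, (Λ c).Nonempty) (hsub : ∀ c, Λ c ⊆ V)
    (hmono : ∀ c c', c < c' → ∀ w ∈ Λ c, ∀ w' ∈ Λ c', w ≤ w')
    (hsplit : ∀ w ∈ V, (∑ c, if w ∈ Λ c then d c w else 0) ≤ n w - 1)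
    (hcount : ∀ c, m c + 1 ≤ ∑ w ∈ Λ c, (d c w + 1))
    (hV : V.card = 14) (hslots : ∑ w ∈ V, (n w - 1) = 6) :
    ∑ c, m c ≤ 19 := by
  have h := chain_ceiling V n Λ d m hne hsub hmono hsplit hcount
  rw [hV, hslots] at h
  exact h

/-- **Ceiling 19 at a TWO-WEYL-PAIR point** (`|V| = 10`, degree budget `10`). [folklore] -/
theorem chain_ceiling_nineteen_of_twoPairs (V : Finset ℝ) (n : ℝ → ℕ) {C : ℕ} (Λ : Fin C → Finset ℝ) (d : Fin C → ℝ → ℕ)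
    (m : Fin C → ℕ) (hne : ∀ c, (Λ c).Nonempty) (hsub : ∀ c, Λ c ⊆ V)
    (hmono : ∀ c c', c < c' → ∀ w ∈ Λ c, ∀ w' ∈ Λ c', w ≤ w')
    (hsplit : ∀ w ∈ V, (∑ c, if w ∈ Λ c then d c w else 0) ≤ n w - 1)
    (hcount : ∀ c, m c + 1 ≤ ∑ w ∈ Λ c, (d c w + 1))
    (hV : V.card = 10) (hslots : ∑ w ∈ V, (n w - 1) = 10) :
    ∑ c, m c ≤ 19 := by
  have h := chain_ceiling V n Λ d m hne hsub hmono hsplit hcount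
  rw [hV, hslots] at h
  exact h

/-- **Ceiling 17 at a THREE-WEYL-PAIR point** (`|V| = 6`, degree budget `12`). [folklore] -/
theorem chain_ceiling_seventeen_of_threePairs (V : Finset ℝ) (n : ℝ → ℕ) {C : ℕ} (Λ : Fin C → Finset ℝ) (d : Fin C → ℝ → ℕ)
    (m : Fin C → ℕ) (hne : ∀ c, (Λ c).Nonempty) (hsub : ∀ c, Λ c ⊆ V)
    (hmono : ∀ c c', c < c' → ∀ w ∈ Λ c, ∀ w' ∈ Λ c', w ≤ w')
    (hsplit : ∀ w ∈ V, (∑ c, if w ∈ Λ c then d c w else 0) ≤ n w - 1)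
    (hcount : ∀ c, m c + 1 ≤ ∑ w ∈ Λ c, (d c w + 1))
    (hV : V.card = 6) (hslots : ∑ w ∈ V, (n w - 1) = 12) :
    ∑ c, m c ≤ 17 := by
  have h := chain_ceiling V n Λ d m hne hsub hmono hsplit hcount
  rw [hV, hslots] at h
  exact h

end Summit.ValiantsHypothesis.ValiantsHypothesis.Theorems.LacunarySymmetroidMatrixDescartes.WallBubbling
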